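import Literature.NumberTheory.PAdicHodge.AinfWeierstrassEtaPeriod
import Literature.NumberTheory.EllipticCurves.FormalGroupMultiplicationPrimeDecompositionInt
import Literature.NumberTheory.EllipticCurves.FormalGroupVerschiebungHasseZeroProofs
import HarnessLib

/-!
# The η-Hasse congruence: `p ∣ [X^j]R_p` for `j < p`, and `[X^p]R_p ≡ g₀·[X^p][p] − g_{p−1} (mod p)`

Topic `Literature/NumberTheory/PAdicHodge`; namespace `Literature.NumberTheory.PAdicHodge.AinfTop`. THEOREMS ONLY (no definition,
no named fact, no instance, no `sorry`).

For an integral Weierstrass equation `W/ℤ` and a prime `p`, the integral multiplication defect `R_p = mulDefectInt W p ∈ ℤ⟦X⟧` of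
the quasi-period function `η₀` (`η₀([p]X) = p·η₀(X) + R_p(X)`, tree `formalQuasiPeriod_subst_formalMul`, file
`AinfWeierstrassEtaPeriod`) controls the transversality `∫_τ η ∉ Fil¹ B_dR⁺` of the η-period through the "η-Hasse congruence"
`p ∣ [X^j]R_p (j < p)`, `p ∤ [X^p]R_p` (tree `mulDefectC_not_mem_span_of_etaHasse`, file `AinfWeierstrassEtaHasseCriterion`).
Here this congruence is COMPUTED from `η₀ = Σ (g_{n−1}/n) Xⁿ` (`g = formalQuasiPeriodIntegrand`, integral) and Silverman's
`[p](X) = p·f(X) + g(X^p)` (AEC IV.4.4, tree `formalMul_prime_eq_add_subst_X_pow_int`): modulo `X^{p+1}`,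
`[p]^d ≡ p^d f^d` for `d ≥ 2` and `[p] ≡ p f + [X^p][p]·X^p`, so with `v_p(p^d/d) ≥ 1`:

* `prime_dvd_coeff_mulDefectInt_of_lt` — **`p ∣ [X^j]R_p` for all `1 ≤ j < p`, UNCONDITIONALLY** (the "low" half of the
  η-Hasse congruence is automatic);
* `prime_dvd_coeff_mulDefectInt_iff` — **`p ∣ [X^p]R_p ⟺ p ∣ g₀·[X^p][p]_W − g_{p−1}`**, `gₙ = [Xⁿ] g_W`;
* `prime_dvd_coeff_mulDefectInt_iff_of_hasseCoeff_eq_zero` — at supersingular reduction (`p` odd, `A_p(W mod p) = 0`, so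
  `p ∣ [X^p][p]_W`): **`p ∣ [X^p]R_p ⟺ p ∣ g_{p−1} = [X^{p−1}] g_W = [z^{p+1}](x(z)ω(z)/dz)`** — the η-HASSE INVARIANT
  `B_p(W) := [z^{p−1}] g_W (mod p)`, the coefficient extracted from the differential of the second kind `x ω` exactly as the
  Hasse invariant is extracted from `ω` (Katz: `A_p ≡ [z^{p−1}](ω/dz)`).

So the η-Hasse hypothesis of the de Rham assembly (`DeRhamSupersingularOfEtaHasse`) is the single condition `p ∤ B_p(W)`. That
`A_p(W) = 0 ⇒ B_p(W) ≠ 0 (mod p)` for a nonsingular `W mod p` (surjectivity of the Cartier operator `H¹_dR → H⁰(Ω¹)`) is NOT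
proved here. BSD is not proved by any of this.

## References
* [Katz1981CrystallineDieudonne] N. M. Katz, *Crystalline cohomology, Dieudonné modules, and Jacobi sums* (1981), §5.1.
* [SilvermanAEC2009] J. H. Silverman, *The Arithmetic of Elliptic Curves*, IV.1.1, IV.4.4.
* [Colmez1992PeriodesAbeliennes] P. Colmez, Math. Ann. 292 (1992), §2.
-/

noncomputable section

open PowerSeries

namespace Literature.NumberTheory.PAdicHodge

open Literature.NumberTheory.EllipticCurves WeierstrassCurve

namespace AinfTop

/-! ## §1 Power-series bookkeeping modulo `X^{p+1}` -/

section Series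

variable {S : Type*} [CommRing S]

/-- `[X^j](P^d) = 0` for `j < d` when `P(0) = 0`. [folklore] -/
private theorem coeff_pow_eq_zero_of_lt {P : S⟦X⟧} (hP : constantCoeff P = 0) {d j : ℕ} (hj : j < d) :
    coeff j (P ^ d) = 0 :=
  (PowerSeries.X_pow_dvd_iff.1 (pow_dvd_pow_of_dvd (PowerSeries.X_dvd_iff.2 hP) d)) j hj

/-- **`[X^j](c·F + G)^d = c^d·[X^j]F^d` for `d ≥ 2`, `j ≤ p`**, when `F(0) = 0` and `X^p ∣ G` (every other term of the binomial
expansion is divisible by `X^{p+1}`). [cite: SilvermanAEC2009, IV.4.4] -/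
private theorem coeff_pow_add_eq {F G : S⟦X⟧} (c : S) {p : ℕ} (hp : 1 ≤ p) (hF : constantCoeff F = 0)
    (hG : ∀ m, m < p → coeff m G = 0) {d : ℕ} (hd : 2 ≤ d) {j : ℕ} (hj : j ≤ p) :
    coeff j ((C c * F + G) ^ d) = c ^ d * coeff j (F ^ d) := by
  have hXF : X ∣ C c * F := dvd_mul_of_dvd_right (PowerSeries.X_dvd_iff.2 hF) _
  have hXG : X ^ p ∣ G := PowerSeries.X_pow_dvd_iff.2 hG
  rw [add_pow, Finset.sum_range_succ, Nat.sub_self, pow_zero, mul_one, Nat.choose_self, Nat.cast_one, mul_one, map_add,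
    mul_pow, ← map_pow, coeff_C_mul]
  suffices h : coeff j (∑ k ∈ Finset.range d, (C c * F) ^ k * G ^ (d - k) * (d.choose k : S⟦X⟧)) = 0 by
    rw [h, zero_add]
  refine (PowerSeries.X_pow_dvd_iff (n := p + 1)).1 (Finset.dvd_sum fun k hk => ?_) j (by omega)
  have hk : k < d := Finset.mem_range.1 hk
  have h1 : (X : S⟦X⟧) ^ k ∣ (C c * F) ^ k := pow_dvd_pow_of_dvd hXF k
  have h2 : (X : S⟦X⟧) ^ (p * (d - k)) ∣ G ^ (d - k) := by rw [pow_mul]; exact pow_dvd_pow_of_dvd hXG _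
  have h3 : (X : S⟦X⟧) ^ (p + 1) ∣ X ^ k * X ^ (p * (d - k)) := by
    rw [← pow_add]
    refine pow_dvd_pow _ ?_
    rcases Nat.lt_or_ge (d - k) 2 with h | h
    · have : d - k = 1 := by omega
      rw [this]; omega
    · nlinarith
  exact (h3.trans (mul_dvd_mul h1 h2)).trans (dvd_mul_right _ _)

/-- `[X^j](c·F + G) = c·[X^j]F` for `j < p` when `X^p ∣ G`. [folklore] -/
private theorem coeff_add_eq_of_lt {F G : S⟦X⟧} (c : S) {p j : ℕ} (hG : ∀ m, m < p → coeff m G = 0) (hj : j < p) :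
    coeff j (C c * F + G) = c * coeff j F := by
  rw [map_add, coeff_C_mul, hG j hj, add_zero]

end Series

/-! ## §2 `p`-adic size of rational numbers (`‖·‖` on `ℚ_p`) -/

section Norms

variable {p : ℕ} [hp : Fact p.Prime]

/-- `‖x‖ < 1 ⟺ ‖x‖ ≤ 1/p` in `ℚ_p`. [folklore] -/
private theorem norm_lt_one_iff_le (x : ℚ_[p]) : ‖x‖ < 1 ↔ ‖x‖ ≤ (p : ℝ)⁻¹ := by
  rw [← zpow_neg_one, Padic.norm_le_pow_iff_norm_lt_pow_add_one, neg_add_cancel, zpow_zero]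

/-- A finite sum of elements of norm `< 1` has norm `< 1` (ultrametric). [folklore] -/
private theorem norm_sum_lt_one {ι : Type*} (s : Finset ι) (f : ι → ℚ_[p]) (h : ∀ i ∈ s, ‖f i‖ < 1) :
    ‖∑ i ∈ s, f i‖ < 1 := by
  rw [norm_lt_one_iff_le]
  exact IsUltrametricDist.norm_sum_le_of_forall_le_of_nonneg (inv_nonneg.2 (Nat.cast_nonneg _))
    fun i hi => (norm_lt_one_iff_le _).1 (h i hi)

/-- `‖x + y‖ < 1` from `‖x‖, ‖y‖ < 1`. [folklore] -/
private theorem norm_add_lt_one {x y : ℚ_[p]} (hx : ‖x‖ < 1) (hy : ‖y‖ < 1) : ‖x + y‖ < 1 :=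
  (IsUltrametricDist.norm_add_le_max x y).trans_lt (max_lt hx hy)

/-- `‖x · z‖ < 1` for `‖x‖ < 1` and an integer `z`. [folklore] -/
private theorem norm_mul_intCast_lt_one {x : ℚ_[p]} (hx : ‖x‖ < 1) (z : ℤ) : ‖x * (z : ℚ_[p])‖ < 1 := by
  rw [norm_mul]
  exact (mul_le_of_le_one_right (norm_nonneg _) (Padic.norm_int_le_one z)).trans_lt hx

/-- **`‖pⁿ/n‖_p < 1` for `n ≥ 1`** (`v_p(n) < n`). [folklore] -/
private theorem norm_pow_div_lt_one {n : ℕ} (hn : n ≠ 0) : ‖((p : ℚ_[p]) ^ n / n)‖ < 1 := by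
  have hp1 : 1 < p := hp.out.one_lt
  obtain ⟨e, m, hm, hnm⟩ := Nat.exists_eq_pow_mul_and_not_dvd hn p hp1.ne'
  have hm0 : m ≠ 0 := by rintro rfl; exact hm (dvd_zero p)
  have hnorm_m : ‖(m : ℚ_[p])‖ = 1 :=
    le_antisymm (by exact_mod_cast Padic.norm_int_le_one (m : ℤ)) (not_lt.1 (mt Padic.norm_natCast_lt_one_iff.1 hm))
  have he : e < n := by
    calc e < p ^ e := Nat.lt_pow_self hp1
      _ ≤ p ^ e * m := Nat.le_mul_of_pos_right _ (Nat.pos_of_ne_zero hm0)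
      _ = n := hnm.symm
  have hpR : (1 : ℝ) < p := by exact_mod_cast hp1
  have hp0 : (0 : ℝ) < p := by positivity
  have hnorm_n : ‖(n : ℚ_[p])‖ = ((p : ℝ) ^ e)⁻¹ := by
    rw [hnm, Nat.cast_mul, Nat.cast_pow, norm_mul, norm_pow, Padic.norm_p, hnorm_m, mul_one, inv_pow]
  rw [norm_div, norm_pow, Padic.norm_p, hnorm_n, inv_pow, div_eq_mul_inv, inv_inv, mul_comm, ← div_eq_mul_inv,
    div_lt_one (pow_pos hp0 _)]
  exact pow_lt_pow_right₀ hpR he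

/-- `‖p/j‖_p < 1` for `0 < j < p`. [folklore] -/
private theorem norm_p_div_lt_one {j : ℕ} (hj0 : 0 < j) (hjp : j < p) : ‖((p : ℚ_[p]) / j)‖ < 1 := by
  have hj : ¬ p ∣ j := fun h => absurd (Nat.le_of_dvd hj0 h) (not_le.2 hjp)
  have hnorm_j : ‖(j : ℚ_[p])‖ = 1 :=
    le_antisymm (by exact_mod_cast Padic.norm_int_le_one (j : ℤ)) (not_lt.1 (mt Padic.norm_natCast_lt_one_iff.1 hj))
  rw [norm_div, hnorm_j, div_one, Padic.norm_p]
  exact inv_lt_one_of_one_lt₀ (by exact_mod_cast hp.out.one_lt)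

/-- Two integers at `p`-adic distance `< 1` are simultaneously divisible by `p`. [folklore] -/
private theorem dvd_iff_dvd_of_norm_sub_lt_one {a b : ℤ} (h : ‖((a : ℚ_[p]) - b)‖ < 1) : (p : ℤ) ∣ a ↔ (p : ℤ) ∣ b := by
  rw [← Int.cast_sub, Padic.norm_intCast_lt_one_iff] at h
  constructor
  · intro ha; have := dvd_sub ha h; rwa [sub_sub_cancel] at this
  · intro hb; have := dvd_add h hb; rwa [sub_add_cancel] at this

end Norms

/-! ## §3 The coefficients of `R_p` in degrees `≤ p` -/

section Main

variable (W : WeierstrassCurve ℤ) (p : ℕ) [hp : Fact p.Prime]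

/-- **`[p]_W = p·F + G` over `ℚ`** with `F(0) = 0`, `X^p ∣ G` and `[X^p]G = [X^p][p]_W` (Silverman AEC IV.4.4 read rationally).
[cite: SilvermanAEC2009, IV.4.4] -/
private theorem exists_formalMul_rat_eq :
    ∃ F G : ℚ⟦X⟧, (W.map (Int.castRingHom ℚ)).formalMul p = C (p : ℚ) * F + G ∧ constantCoeff F = 0 ∧
      (∀ m, m < p → coeff m G = 0) ∧ coeff p G = ((coeff p (W.formalMul p) : ℤ) : ℚ) ∧
      (∀ d j, coeff j (F ^ d) = ((coeff j (W.formalMulPRemPartInt (p := p) ^ d) : ℤ) : ℚ)) := by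
  have hp0 : p ≠ 0 := hp.out.ne_zero
  refine ⟨PowerSeries.map (Int.castRingHom ℚ) (W.formalMulPRemPartInt (p := p)),
    PowerSeries.map (Int.castRingHom ℚ) ((W.formalMulPDivPartInt (p := p)).subst ((X : ℤ⟦X⟧) ^ p)), ?_, ?_, ?_, ?_, ?_⟩
  · rw [← WeierstrassCurve.map_formalMul, W.formalMul_prime_eq_add_subst_X_pow_int (p := p), map_add, map_mul, map_natCast,
      map_natCast]
  · rw [← coeff_zero_eq_constantCoeff_apply, coeff_map, coeff_zero_eq_constantCoeff_apply,
      W.constantCoeff_formalMulPRemPartInt, map_zero]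
  · intro m hm
    rw [coeff_map, coeff_subst_X_pow hp0]
    by_cases hpm : p ∣ m
    · rcases Nat.eq_zero_or_pos m with rfl | hm0
      · rw [if_pos hpm, Nat.zero_div, coeff_zero_eq_constantCoeff, W.constantCoeff_formalMulPDivPartInt, map_zero, map_zero]
      · exact absurd (Nat.le_of_dvd hm0 hpm) (not_le.2 hm)
    · rw [if_neg hpm, map_zero]
  · rw [coeff_map, coeff_subst_X_pow hp0, if_pos (dvd_refl p), Nat.div_self hp.out.pos, W.coeff_one_formalMulPDivPartInt,
      Algebra.algebraMap_self_apply, eq_intCast]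
  · intro d j
    rw [← map_pow, coeff_map, eq_intCast]

/-- `η₀(0) = 0` and `[X^{n+1}]η₀ = g_n/(n+1)` with `g_n = [X^n] g_W ∈ ℤ`. [cite: Katz1981CrystallineDieudonne, §5.1] -/
private theorem coeff_succ_formalQuasiPeriod_rat (n : ℕ) :
    coeff (n + 1) (W.map (Int.castRingHom ℚ)).formalQuasiPeriod =
      (1 / (n + 1 : ℚ)) * ((coeff n W.formalQuasiPeriodIntegrand : ℤ) : ℚ) := by
  rw [WeierstrassCurve.coeff_succ_formalQuasiPeriod, Algebra.algebraMap_self_apply, ← W.map_formalQuasiPeriodIntegrand,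
    coeff_map, eq_intCast]

omit hp in
/-- **`[X^j](η₀ ∘ [p]) = Σ_{d ≤ j} [X^d]η₀ · [X^j][p]^d`** (finite since `[p](0) = 0`). [cite: Katz1981CrystallineDieudonne, §5.1] -/
private theorem coeff_subst_formalMul_eq_sum (j : ℕ) :
    coeff j ((W.map (Int.castRingHom ℚ)).formalQuasiPeriod.subst ((W.map (Int.castRingHom ℚ)).formalMul p)) =
      ∑ d ∈ Finset.range (j + 1), coeff d (W.map (Int.castRingHom ℚ)).formalQuasiPeriod *
        coeff j ((W.map (Int.castRingHom ℚ)).formalMul p ^ d) := by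
  have hP0 := (W.map (Int.castRingHom ℚ)).constantCoeff_formalMul p
  rw [coeff_subst' (HasSubst.of_constantCoeff_zero' hP0)]
  refine finsum_eq_sum_of_support_subset _ fun d hd => ?_
  rw [Finset.coe_range, Set.mem_Iio]
  by_contra hdj
  apply hd
  change coeff d _ • coeff j _ = 0
  rw [coeff_pow_eq_zero_of_lt hP0 (by omega), smul_zero]

omit hp in
/-- **`[X^j]R_p = [X^j](η₀ ∘ [p]) − p·[X^j]η₀`** (`η₀([p]X) = p η₀ + R_p`, `R_p` integral). [cite: Katz1981CrystallineDieudonne, §5.1] -/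
private theorem coeff_mulDefectInt_eq (j : ℕ) :
    ((coeff j (mulDefectInt W p) : ℤ) : ℚ) =
      coeff j ((W.map (Int.castRingHom ℚ)).formalQuasiPeriod.subst ((W.map (Int.castRingHom ℚ)).formalMul p)) -
        p * coeff j (W.map (Int.castRingHom ℚ)).formalQuasiPeriod := by
  have h := congrArg (coeff j) ((W.map (Int.castRingHom ℚ)).formalQuasiPeriod_subst_formalMul p)
  rw [map_add, ← map_natCast (C (R := ℚ)) p, coeff_C_mul, ← map_mulDefectInt, coeff_map, eq_intCast] at h
  rw [h, add_sub_cancel_left]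

end Main

/-! ## §4 The η-Hasse congruence -/

section EtaHasse

variable (W : WeierstrassCurve ℤ) (p : ℕ) [hp : Fact p.Prime]

/-- The terms `d ≥ 2` of `[X^j](η₀ ∘ [p])`, `j ≤ p`, have `p`-adic norm `< 1`: `[X^d]η₀ · [X^j][p]^d = (p^d/d)·g_{d−1}·[X^j]f^d`.
[cite: SilvermanAEC2009, IV.4.4] [cite: Katz1981CrystallineDieudonne, §5.1] -/
private theorem norm_term_lt_one {F G : ℚ⟦X⟧} (hP : (W.map (Int.castRingHom ℚ)).formalMul p = C (p : ℚ) * F + G)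
    (hF0 : constantCoeff F = 0) (hG : ∀ m, m < p → coeff m G = 0)
    (hFint : ∀ d j, coeff j (F ^ d) = ((coeff j (W.formalMulPRemPartInt (p := p) ^ d) : ℤ) : ℚ))
    {d j : ℕ} (hd : 2 ≤ d) (hj : j ≤ p) :
    ‖((coeff d (W.map (Int.castRingHom ℚ)).formalQuasiPeriod * coeff j ((W.map (Int.castRingHom ℚ)).formalMul p ^ d) : ℚ) :
      ℚ_[p])‖ < 1 := by
  obtain ⟨n, rfl⟩ : ∃ n, d = n + 1 := ⟨d - 1, by omega⟩
  rw [coeff_succ_formalQuasiPeriod_rat, hP, coeff_pow_add_eq (p : ℚ) hp.out.one_lt.le hF0 hG hd hj, hFint]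
  have h : (((1 / (n + 1 : ℚ)) * ((coeff n W.formalQuasiPeriodIntegrand : ℤ) : ℚ) *
      ((p : ℚ) ^ (n + 1) * ((coeff j (W.formalMulPRemPartInt (p := p) ^ (n + 1)) : ℤ) : ℚ)) : ℚ) : ℚ_[p]) =
      ((p : ℚ_[p]) ^ (n + 1) / (n + 1 : ℕ)) *
        (coeff n W.formalQuasiPeriodIntegrand * coeff j (W.formalMulPRemPartInt (p := p) ^ (n + 1)) : ℤ) := by
    push_cast; ring
  rw [h]
  exact norm_mul_intCast_lt_one (norm_pow_div_lt_one (Nat.succ_ne_zero n)) _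

/-- **The low η-Hasse congruence holds unconditionally: `p ∣ [X^j]R_p` for every `j < p`** (`R_p = mulDefectInt W p`). Modulo
`X^p`, `[p] ≡ p·f`, so `[X^j](η₀∘[p]) = Σ_d (g_{d−1}/d) p^d [X^j]f^d ∈ pℤ_(p)`, and `p·[X^j]η₀ = (p/j) g_{j−1} ∈ pℤ_(p)`.
[cite: Katz1981CrystallineDieudonne, §5.1] [cite: SilvermanAEC2009, IV.4.4] -/
theorem prime_dvd_coeff_mulDefectInt_of_lt {j : ℕ} (hj : j < p) : (p : ℤ) ∣ coeff j (mulDefectInt W p) := by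
  rcases Nat.eq_zero_or_pos j with rfl | hj0
  · rw [coeff_zero_eq_constantCoeff, constantCoeff_mulDefectInt]; exact dvd_zero _
  obtain ⟨F, G, hP, hF0, hG, -, hFint⟩ := exists_formalMul_rat_eq W p
  rw [← Padic.norm_intCast_lt_one_iff, ← Rat.cast_intCast, coeff_mulDefectInt_eq, coeff_subst_formalMul_eq_sum]
  obtain ⟨i, rfl⟩ : ∃ i, j = i + 1 := ⟨j - 1, by omega⟩
  rw [Finset.sum_range_succ', Finset.sum_range_succ', coeff_zero_eq_constantCoeff, WeierstrassCurve.constantCoeff_formalQuasiPeriod,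
    zero_mul, add_zero, pow_one, zero_add, coeff_succ_formalQuasiPeriod_rat, coeff_succ_formalQuasiPeriod_rat, Nat.cast_zero,
    zero_add, div_one, one_mul]
  nth_rw 2 [hP]
  rw [coeff_add_eq_of_lt (p : ℚ) hG hj, ← pow_one F, hFint 1 (i + 1)]
  push_cast
  rw [sub_eq_add_neg]
  refine norm_add_lt_one (p := p) (norm_add_lt_one (p := p) (norm_sum_lt_one (p := p) _ _ fun d _ => ?_) ?_) ?_
  · have h := norm_term_lt_one W p hP hF0 hG hFint (d := d + 1 + 1) (by omega) hj.le
    exact_mod_cast h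
  · have h : ((coeff 0 W.formalQuasiPeriodIntegrand : ℤ) : ℚ_[p]) *
        ((p : ℚ_[p]) * ((coeff (i + 1) (W.formalMulPRemPartInt (p := p) ^ 1) : ℤ) : ℚ_[p])) =
        (p : ℚ_[p]) * (coeff 0 W.formalQuasiPeriodIntegrand * coeff (i + 1) (W.formalMulPRemPartInt (p := p) ^ 1) : ℤ) := by
      push_cast; ring
    rw [h]
    exact norm_mul_intCast_lt_one (by rw [Padic.norm_p]; exact inv_lt_one_of_one_lt₀ (by exact_mod_cast hp.out.one_lt)) _
  · rw [norm_neg, show ((p : ℚ_[p]) * (1 / ((i : ℚ_[p]) + 1) * ((coeff i W.formalQuasiPeriodIntegrand : ℤ) : ℚ_[p]))) =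
      ((p : ℚ_[p]) / (i + 1 : ℕ)) * ((coeff i W.formalQuasiPeriodIntegrand : ℤ) : ℚ_[p]) by push_cast; ring]
    exact norm_mul_intCast_lt_one (norm_p_div_lt_one (Nat.succ_pos i) hj) _

/-- **The top η-Hasse coefficient: `p ∣ [X^p]R_p ⟺ p ∣ g₀·[X^p][p]_W − g_{p−1}`**, `gₙ = [Xⁿ] g_W`
(`g_W = formalQuasiPeriodIntegrand`, `g₀ = a₁² + 4a₂`-type integer, `[X^p][p]_W ≡ A_p`): modulo `X^{p+1}`,
`[X^p](η₀∘[p]) ≡ g₀·([X^p][p]) (mod pℤ_(p))` and `p·[X^p]η₀ = g_{p−1}`. [cite: Katz1981CrystallineDieudonne, §5.1]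
[cite: SilvermanAEC2009, IV.4.4] -/
theorem prime_dvd_coeff_mulDefectInt_iff :
    (p : ℤ) ∣ coeff p (mulDefectInt W p) ↔
      (p : ℤ) ∣ coeff 0 W.formalQuasiPeriodIntegrand * coeff p (W.formalMul p) - coeff (p - 1) W.formalQuasiPeriodIntegrand := by
  have hp0 : 0 < p := hp.out.pos
  obtain ⟨F, G, hP, hF0, hG, hGp, hFint⟩ := exists_formalMul_rat_eq W p
  apply dvd_iff_dvd_of_norm_sub_lt_one (p := p)
  have hcp : coeff p (W.map (Int.castRingHom ℚ)).formalQuasiPeriod =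
      (1 / ((p - 1 : ℕ) + 1 : ℚ)) * ((coeff (p - 1) W.formalQuasiPeriodIntegrand : ℤ) : ℚ) := by
    have h := coeff_succ_formalQuasiPeriod_rat W (p - 1)
    rwa [Nat.sub_add_cancel hp0] at h
  have hcP : coeff p ((W.map (Int.castRingHom ℚ)).formalMul p) =
      (p : ℚ) * ((coeff p (W.formalMulPRemPartInt (p := p) ^ 1) : ℤ) : ℚ) + ((coeff p (W.formalMul p) : ℤ) : ℚ) := by
    rw [hP, map_add, coeff_C_mul, hGp, ← hFint 1 p, pow_one]
  rw [← Rat.cast_intCast (coeff p (mulDefectInt W p)), coeff_mulDefectInt_eq, coeff_subst_formalMul_eq_sum,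
    show Finset.range (p + 1) = Finset.range (p - 1 + 1 + 1) by rw [Nat.sub_add_cancel hp0], Finset.sum_range_succ',
    Finset.sum_range_succ', coeff_zero_eq_constantCoeff, WeierstrassCurve.constantCoeff_formalQuasiPeriod, zero_mul, add_zero,
    pow_one, zero_add, coeff_succ_formalQuasiPeriod_rat, Nat.cast_zero, zero_add, div_one, one_mul, hcp, hcP,
    Nat.cast_pred hp0, sub_add_cancel]
  have hpq : (p : ℚ_[p]) ≠ 0 := Nat.cast_ne_zero.2 hp.out.ne_zero
  have key : ((∑ d ∈ Finset.range (p - 1), coeff (d + 1 + 1) (W.map (Int.castRingHom ℚ)).formalQuasiPeriod *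
        coeff p ((W.map (Int.castRingHom ℚ)).formalMul p ^ (d + 1 + 1)) +
      ((coeff 0 W.formalQuasiPeriodIntegrand : ℤ) : ℚ) *
        ((p : ℚ) * ((coeff p (W.formalMulPRemPartInt (p := p) ^ 1) : ℤ) : ℚ) + ((coeff p (W.formalMul p) : ℤ) : ℚ)) -
      (p : ℚ) * ((1 / (p : ℚ)) * ((coeff (p - 1) W.formalQuasiPeriodIntegrand : ℤ) : ℚ)) : ℚ) : ℚ_[p]) -
      ((coeff 0 W.formalQuasiPeriodIntegrand * coeff p (W.formalMul p) - coeff (p - 1) W.formalQuasiPeriodIntegrand : ℤ) : ℚ_[p]) =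
      ((∑ d ∈ Finset.range (p - 1), coeff (d + 1 + 1) (W.map (Int.castRingHom ℚ)).formalQuasiPeriod *
        coeff p ((W.map (Int.castRingHom ℚ)).formalMul p ^ (d + 1 + 1)) : ℚ) : ℚ_[p]) +
      (p : ℚ_[p]) * (coeff 0 W.formalQuasiPeriodIntegrand * coeff p (W.formalMulPRemPartInt (p := p) ^ 1) : ℤ) := by
    push_cast
    field_simp
    ring
  rw [key]
  refine norm_add_lt_one (p := p) ?_ ?_
  · rw [Rat.cast_sum]
    refine norm_sum_lt_one (p := p) _ _ fun d _ => ?_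
    have h := norm_term_lt_one W p hP hF0 hG hFint (d := d + 1 + 1) (by omega) le_rfl
    exact_mod_cast h
  · exact norm_mul_intCast_lt_one (by rw [Padic.norm_p]; exact inv_lt_one_of_one_lt₀ (by exact_mod_cast hp.out.one_lt)) _

/-- **At SUPERSINGULAR reduction the η-Hasse congruence is `p ∤ B_p(W)`**, `B_p(W) := [X^{p−1}] g_W` (the `z^{p+1}`-coefficient of
`x(z)ω(z)/dz`): for `p` odd with `A_p(W mod p) = 0` one has `p ∣ [X^p][p]_W`, so `p ∣ [X^p]R_p ⟺ p ∣ [X^{p−1}] g_W`.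
[cite: Katz1981CrystallineDieudonne, §5.1] [cite: SilvermanAEC2009, IV.7.5] -/
theorem prime_dvd_coeff_mulDefectInt_iff_of_hasseCoeff_eq_zero (hp2 : p ≠ 2)
    (hA : (W.map (Int.castRingHom (ZMod p))).hasseCoeff p = 0) :
    (p : ℤ) ∣ coeff p (mulDefectInt W p) ↔ (p : ℤ) ∣ coeff (p - 1) W.formalQuasiPeriodIntegrand := by
  have hcp : (p : ℤ) ∣ coeff p (W.formalMul p) := by
    have h := (W.map (Int.castRingHom (ZMod p))).coeff_formalMul_prime_eq_zero_of_hasseCoeff_eq_zero p hp2 hA (n := p)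
      (fun h => absurd (Nat.le_of_dvd hp.out.pos h) (not_le.2 (by nlinarith [hp.out.two_le])))
    rw [← WeierstrassCurve.map_formalMul, PowerSeries.coeff_map, eq_intCast] at h
    exact (ZMod.intCast_zmod_eq_zero_iff_dvd _ p).1 h
  rw [prime_dvd_coeff_mulDefectInt_iff]
  constructor
  · intro h
    have h2 := dvd_sub (dvd_mul_of_dvd_right hcp (coeff 0 W.formalQuasiPeriodIntegrand)) h
    rwa [sub_sub_cancel] at h2
  · intro h
    exact dvd_sub (dvd_mul_of_dvd_right hcp (coeff 0 W.formalQuasiPeriodIntegrand)) h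

end EtaHasse

end AinfTop

end Literature.NumberTheory.PAdicHodge

end
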